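/-
COR-CM (cell pub-hodgecm2, stage 2 of the Hodge ladder) — count-neutral KERNEL COMBINATORICS «the named quartic-twist cyclotomic fields ℚ(ζ₆₅), ℚ(ζ₈₅): exactly β − 2
faces» (seat prover-pub-hodgecm2-b23-g41-0, binder prover b23, gen 41; claim QUARTIC-TRANSPORT F5b, HOME/INBOX.md l.10098; blanket `CorCM/FaceQuarticTwist*` l.10129).
Theorems only: F4 (`CorCM/FaceQuarticTwistGeneration.lean`) instantiated with the quartic `Aut`-data of F5a (`CorCM/FaceQuarticTwistCyclotomicDatum.lean`) BY NAME;
no geometry, no named fact, nothing asserted; `Interfaces.lean` (C1), every E term, B01, `Transposition/*`, `PortJoin/*` untouched.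
HONEST FRAMING (COORDINATOR RULING — HODGE FRAMING CORRECTION, 2026-08-21T11:55:35Z): `HC_CM` is NOT proved, here or anywhere in the tree; every
`HodgeConjectureFor` below is CONDITIONAL on face periods; no period is produced.
T5: n/a-class — the only Prop hypothesis binder displayed is INT2-GEN's period hypothesis on the produced face set; checker: self, 2026-08-23.
-/
import Summits.HodgeConjecture.CorCM.FaceQuarticTwistGeneration
import Summits.HodgeConjecture.CorCM.FaceQuarticTwistCyclotomicDatum

/-!
# `ℚ(ζ₆₅)` and `ℚ(ζ₈₅)`: EXACTLY `β − 2` generating rank-four faces (quartic twists with a screw), no datum hypothesis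

For `K` ANY CM field that is a `65`-th (resp. `85`-th) cyclotomic extension of `ℚ` (degree `48`, resp. `64`; `Aut(K) ≅ ℤ/4 × ℤ/12`, resp. `ℤ/4 × ℤ/16`, complex
conjugation `↦ (2, 0)`, F5a; the instance `[IsGalois ℚ K]` is `IsCyclotomicExtension.isGalois {N} ℚ K`) and any complex embedding `σ₀`:
* `isLeast_card_faces_hgen_cyclotomic_sixtyFive` / `_eightyFive`: the least number of rank-four faces `𝒮` with INT2-GEN's `hgen(𝒮, σ₀)` is EXACTLY
  `β(K) − 2` (`β(K) = #Block conjT`, the simple CM isogeny classes split by `K`) — seat b09's SCREW law through F3/F4;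
* `exists_faceSet_cyclotomic_sixtyFive` / `_eightyFive`: a face set of size `β(K) − 2` EXISTS whose periods on the universe of record give the Hodge
  conjecture for every abelian variety dominated by a product of CM abelian varieties with CM by subfields of `K` — CONDITIONAL; `HC_CM` is NOT proved.

## References
* [Washington1997] L. C. Washington, Introduction to Cyclotomic Fields, GTM 83, Thm. 2.5.
* [Pohlmann1968] H. Pohlmann, Algebraic cycles on abelian varieties of complex multiplication type, Ann. of Math. 88 (1968), Thm 1.
-/

noncomputable section

open CategoryTheory NumberField NumberField.ComplexEmbedding
open Literature.AlgebraicGeometry Literature.AlgebraicGeometry.Motives Literature.AlgebraicGeometry.HodgeTheory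
open Literature.AlgebraicGeometry.ComplexMultiplication Literature.AlgebraicGeometry.Milne1999
open Literature.NumberTheory.Automorphic
open Literature.NumberTheory.Automorphic.PicardCM
open Summit.HodgeConjecture.CorCM.Domination

namespace Summit.HodgeConjecture.CorCM.FaceQuarticTwist

open Summit.HodgeConjecture.CorCM.Prior.AllgGroup.RfwfAllgGroup
open Summit.HodgeConjecture.CorCM.Census.BlockParity

/-- **`ℚ(ζ₆₅)`: EXACTLY `β(K) − 2` generating rank-four faces** (quartic twist over `ℤ/12`, screw). [cite: Washington1997, Thm. 2.5] -/
theorem isLeast_card_faces_hgen_cyclotomic_sixtyFive (K : Type) [Field K] [NumberField K] [IsCMField K] [IsCyclotomicExtension {65} ℚ K]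
    [IsGalois ℚ K] (σ₀ : K →+* ℂ) :
    IsLeast {m : ℕ | ∃ 𝒮 : Finset (Face K), 𝒮.card = m ∧
      ∀ f : Face K, lefChar f.corner (fun _ => ({σ₀} : Finset (K →+* ℂ))) ∈ AddSubgroup.closure
        {a : Asym K | ∃ g ∈ (𝒮 : Set (Face K)), ∃ σ : K →+* ℂ, a = lefChar g.corner (fun _ => ({σ} : Finset (K →+* ℂ)))}}
      (Fintype.card (Block (conjT : GalT K)) - 2) := by
  obtain ⟨c, ε, hcσ, hε, hεc⟩ := exists_quarticAutDatum_cyclotomic_sixtyFive K σ₀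
  have h := isLeast_card_faces_hgen_of_quartic_aut σ₀ ε hε hcσ hεc three_le_card_zmod_twelve
  rwa [if_pos exists_four_dvd_addOrderOf_zmod_twelve] at h

/-- **`ℚ(ζ₈₅)`: EXACTLY `β(K) − 2` generating rank-four faces** (quartic twist over `ℤ/16`, screw). [cite: Washington1997, Thm. 2.5] -/
theorem isLeast_card_faces_hgen_cyclotomic_eightyFive (K : Type) [Field K] [NumberField K] [IsCMField K] [IsCyclotomicExtension {85} ℚ K]
    [IsGalois ℚ K] (σ₀ : K →+* ℂ) :
    IsLeast {m : ℕ | ∃ 𝒮 : Finset (Face K), 𝒮.card = m ∧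
      ∀ f : Face K, lefChar f.corner (fun _ => ({σ₀} : Finset (K →+* ℂ))) ∈ AddSubgroup.closure
        {a : Asym K | ∃ g ∈ (𝒮 : Set (Face K)), ∃ σ : K →+* ℂ, a = lefChar g.corner (fun _ => ({σ} : Finset (K →+* ℂ)))}}
      (Fintype.card (Block (conjT : GalT K)) - 2) := by
  obtain ⟨c, ε, hcσ, hε, hεc⟩ := exists_quarticAutDatum_cyclotomic_eightyFive K σ₀
  have h := isLeast_card_faces_hgen_of_quartic_aut σ₀ ε hε hcσ hεc three_le_card_zmod_sixteen
  rwa [if_pos exists_four_dvd_addOrderOf_zmod_sixteen] at h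

/-- **`ℚ(ζ₆₅)`: a face set of size `β(K) − 2` whose periods give HC of the slice** (INT2-GEN socket BY NAME; CONDITIONAL — `HC_CM` is NOT proved).
[cite: Washington1997, Thm. 2.5] [cite: Pohlmann1968, Thm. 1] -/
theorem exists_faceSet_cyclotomic_sixtyFive (K : CMField) [IsCyclotomicExtension {65} ℚ (K : Type)] [hGal : IsGalois ℚ K]
    (σ₀ : (K : Type) →+* ℂ) :
    ∃ 𝒮 : Finset (Face K), 𝒮.card + 2 = Fintype.card (Block (conjT : GalT K)) ∧
      ((∀ f ∈ 𝒮, ∃ ι₁ : K →+* ℂ, f.Admissible ι₁ ∧ ∃ (V : HermSpace3 K ι₁) (σ : K →+* ℂ),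
        (Model.picardCMUniverse exists_isReal_hodgeModel_holds hodgePQ_independent_of_hodgeModel_holds
          BallQuotient.ballQuotientUniformised_holds cmAbelianVarietyRealised_holds).PeriodNV ι₁ V K f.psi σ) →
      ∀ {P A : AbelianVariety ℂ}, AbelianVariety.IsProductOf (fun A : AbelianVariety ℂ =>
        ∃ (E : Type) (_ : Field E) (_ : NumberField E) (_ : IsCMField E) (_ : E →+* (K : Type)) (Φ : CMType E)
          (ι : 𝓞 E →+* End A) (ϑ : E →+* Module.End ℂ (complexBetti A.X 1)),
          IsCMTypeRealisation Φ A ι ϑ) P →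
      AVDominatedBy A P → HodgeConjectureFor A.dim A.X) := by
  obtain ⟨c, ε, hcσ, hε, hεc⟩ := exists_quarticAutDatum_cyclotomic_sixtyFive (K : Type) σ₀
  obtain ⟨𝒮, hcard, h⟩ := hodgeConjectureFor_of_quartic_aut_of_exists_facePeriod K σ₀ ε hε hcσ hεc three_le_card_zmod_twelve
  rw [if_pos exists_four_dvd_addOrderOf_zmod_twelve] at hcard
  exact ⟨𝒮, by omega, h⟩

/-- **`ℚ(ζ₈₅)`: a face set of size `β(K) − 2` whose periods give HC of the slice** (CONDITIONAL — `HC_CM` is NOT proved).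
[cite: Washington1997, Thm. 2.5] [cite: Pohlmann1968, Thm. 1] -/
theorem exists_faceSet_cyclotomic_eightyFive (K : CMField) [IsCyclotomicExtension {85} ℚ (K : Type)] [hGal : IsGalois ℚ K]
    (σ₀ : (K : Type) →+* ℂ) :
    ∃ 𝒮 : Finset (Face K), 𝒮.card + 2 = Fintype.card (Block (conjT : GalT K)) ∧
      ((∀ f ∈ 𝒮, ∃ ι₁ : K →+* ℂ, f.Admissible ι₁ ∧ ∃ (V : HermSpace3 K ι₁) (σ : K →+* ℂ),
        (Model.picardCMUniverse exists_isReal_hodgeModel_holds hodgePQ_independent_of_hodgeModel_holds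
          BallQuotient.ballQuotientUniformised_holds cmAbelianVarietyRealised_holds).PeriodNV ι₁ V K f.psi σ) →
      ∀ {P A : AbelianVariety ℂ}, AbelianVariety.IsProductOf (fun A : AbelianVariety ℂ =>
        ∃ (E : Type) (_ : Field E) (_ : NumberField E) (_ : IsCMField E) (_ : E →+* (K : Type)) (Φ : CMType E)
          (ι : 𝓞 E →+* End A) (ϑ : E →+* Module.End ℂ (complexBetti A.X 1)),
          IsCMTypeRealisation Φ A ι ϑ) P →
      AVDominatedBy A P → HodgeConjectureFor A.dim A.X) := by
  obtain ⟨c, ε, hcσ, hε, hεc⟩ := exists_quarticAutDatum_cyclotomic_eightyFive (K : Type) σ₀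
  obtain ⟨𝒮, hcard, h⟩ := hodgeConjectureFor_of_quartic_aut_of_exists_facePeriod K σ₀ ε hε hcσ hεc three_le_card_zmod_sixteen
  rw [if_pos exists_four_dvd_addOrderOf_zmod_sixteen] at hcard
  exact ⟨𝒮, by omega, h⟩

end Summit.HodgeConjecture.CorCM.FaceQuarticTwist

end
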